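/-
Copyright: cell `pub-ymgap` (HUMAN RULING D-0062), Track A of `YM-PLAN.md`, DAG node N20 (= NE7b); R134 acceleration seat
`pub-ymgap-dag-n20-c` (strategy s1, generation 5), module 29.  Released under the licence of the surrounding project.
-/
import Summits.QuantumFields.YangMills.Theorems.BalabanUVNodesN20LCSLabelTowerClassWeight
import Summits.QuantumFields.YangMills.Theorems.BalabanUVNodesN20ByValueTelescoping
import HarnessLib

/-!
# YM-DAG node N20 (= NE7b), strategy s1, module 29: THE LABEL TOWER OF RECORD HAS THE MODULE PROPERTY — the junction with seat n20-d's fourth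
# currency «BY VALUE» (`…N20ByValueTelescoping`): its displayed structural hypothesis `hmod` is a THEOREM for the label tower, so every history
# term's level-`K` weight IS the level-`0` integral of `ρ₀` against the product of the label weights along the averaging chain, and module 28's
# class weight bound reads as ONE joint-sparseness inequality under the bare Wilson state

Track A of `YM-PLAN.md` (cell `pub-ymgap`, HUMAN RULING D-0062), node **N20** = spine estimate NE7b (`T4WeightBudget.RelWeightBound` — NOT PRINTED,
NOT PROVED).  Seat `pub-ymgap-dag-n20-c` (R134, s1), generation 5, module 29 (after 27 `…N20LCSLabelTower` = the object, 28 `…N20LCSLabelTowerClassWeight`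
= the (α)-road's class weight bound on it).  Kernel theorems only: 0 `def`, 0 `sorry`, standard axioms; COUNT-NEUTRAL; `--supports` the K3⁗ item.

WHY.  Seat n20-d (g5) typed the fourth currency over the ABSTRACT tower: on a tower whose operations have the MODULE PROPERTY over level maps `avg j` —
`∫ m·(op j g p).T f dμ_{j+1} = ∫ (m ∘ avg j)·(χ_{j,g,p}·f) dμ_j` (`hmod`, DISPLAYED, «never claimed for any tower of Bałaban's») — history weights
telescope BY VALUE to level `0` (`integral_eterm_eq_pullAlong`, `sum_admS_integral_eterm_eq`, `sum_adm_integral_eterm_eq`).  Module 27's operations ARE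
conditional expectations given the block average (twisted by the label weight): integrating over the FIBRES of `avg j`, they commute with
multiplication by a function of the new field.  THIS FILE proves `hmod` for the label tower and instantiates n20-d's theorems on it.

WHAT.
* §1 (generic, module 27 §1's letters) ★ `integral_mul_ofKernel_wCondKernel`: for bounded measurable `m` (coarse) and `f` (fine),
  `∫ m·(ofKernel κ_w).T f d(ν.map avg) = ∫ (m ∘ avg)·(clampW (w U Ū)·f) dν` (the disintegration `(ν.map avg) ⊗ condLaw = jointLaw` integrated against
  `m(V′)·clampW(w(U,V′))·f(U)`; module 27's `hstep` is the case `m = 1`).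
* §2 (record) `good_comp_avOfRecord` (bounded measurable functions pull back along the averaging of record), ★★ **`hmod_labelTower`** — n20-d's `hmod`
  binder VERBATIM for `labelTowerOfRecord` with `avg j := (avOfRecord F N p.K j).avg`, `χ := labelChi`, every `j`, `h`, `q` (no admissibility needed),
  modulo the (O4) measurability only.
* §3 THE JUNCTION (n20-d's theorems BY NAME at module 27's objects, `μ 0 = Haar` by `lawOfRecord_zero`): ★ `integral_eterm_labelTower_eq_pullAlong`
  (`∫ eterm ρ₀ K h dμ_K = ∫ pullAlong avg labelChi K h · ρ₀ dU₀`: THE LEVEL-`K` WEIGHT OF A LABEL HISTORY IS THE BARE-FIELD INTEGRAL OF `ρ₀` AGAINST THE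
  PRODUCT OF ITS LABEL WEIGHTS READ ALONG THE ITERATED AVERAGES), `sum_admS_integral_labelTower_eq` (class sums by value), and ★★★
  **`integral_sum_pullAlong_le_of_rootedAtZero`** — MODULE 28's CLASS WEIGHT BOUND BY VALUE: for every label-family pattern `E` pinning `D` at level `0`,
  `∫ (Σ_{h ∈ admS … (Kc+1)} pullAlong avg labelChi (Kc+1) h)·ρ₀ dU₀ ≤ (m·e^{Cδ₀ − δ₀g₀⁻²ε″²∕(2N)})^{#D}·∫ ρ₀ dU₀` — ONE JOINT-SPARSENESS INEQUALITY UNDER THE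
  BARE WILSON STATE at `β = g₀⁻²` for the total weight of the label histories whose first (3.2)-family contains `D` (n20-d module 2's (JS) shape,
  here DERIVED for these keys, not displayed).

HONEST FRAMING.  By-name junction of two typed currencies on ONE object; module 27's honest framing applies (T-steps of record, label-indexed choices,
conditional-expectation currency; the 𝐑-step ∕ (A1c) NOT in the tower).  Residual binders as in module 28: the two ζ-laws, the (O4) measurability, the
per-cube regularity letters ([Balaban1985Variational] Thm 1 — NOT asserted), disjoint letter regions.  NE7b NOT PRINTED ∕ NOT PROVED; (α)-instance
0∕1; N20 NOT discharged; typed 28∕28, discharged count untouched; one finite four-torus at fixed `ε` — NOT ℝ⁴, NOT infinite volume, NOT OS, NOT a mass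
gap, NOT Clay.  References (LOCATORS): T. Bałaban, CMP 119 (1988) 243–285 [Balaban1988Convergent] ((3.1)–(3.5) pp. 264–265); CMP 122 (1989) 175–202
[Balaban1989LargeFieldI] ((0.3)–(0.4) p. 176); CMP 122 (1989) 355–392 [Balaban1989LargeFieldII] ((1.71)–(1.72) pp. 378–379).
-/

set_option autoImplicit false

noncomputable section

open scoped BigOperators ENNReal

namespace Summit.QuantumFields.YangMills.BalabanUVNodes.N20LCSLabelTowerByValue

open MeasureTheory ProbabilityTheory
open Literature.MathematicalPhysics.QuantumFieldTheory.Balaban1983to89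
open Literature.MathematicalPhysics.QuantumFieldTheory.Balaban1983to89.T4Continuum
open Literature.MathematicalPhysics.QuantumFieldTheory.Balaban1983to89.T4AveragingDisintegration
  (condLaw jointLaw jointLaw_fst fst_compProd_condLaw integral_jointLaw measurable_graphMap)
open Literature.MathematicalPhysics.QuantumFieldTheory.Balaban1983to89.Node00
open Summit.QuantumFields.BalabanUV.T4Continuum.B16HistoryIndexedRepr (GoodClass)
open Summit.QuantumFields.BalabanUV.T4Continuum.B16HistoryReprChain
open Summit.QuantumFields.BalabanUV.T4Continuum.NE7b.PrefixExtraction (admS admS_subset_adm)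
open Summit.QuantumFields.BalabanUV.T4Continuum.Spine.NE7b.StepKernelOps (ofKernel ofKernel_apply)
open Summit.QuantumFields.BalabanUV.T4Continuum.ShellMeasureAverageIterate (iterMap)
open Summit.QuantumFields.YangMills.BalabanUVNodes.N20LCSLabelTower
open Summit.QuantumFields.YangMills.BalabanUVNodes.N20LCSLabelTowerClassWeight
  (sum_admS_integral_le_labelTower_rootedAtZero)
open Summit.QuantumFields.YangMills.BalabanUVNodes.N20ByValueTelescoping (pullAlong integral_eterm_eq_pullAlong sum_admS_integral_eterm_eq)

/-! ## §1 GENERIC: the weighted conditional kernel step integrates over the fibres of the map -/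

section Generic

variable {α β : Type} [MeasurableSpace α] [MeasurableSpace β] [StandardBorelSpace β] [Nonempty β]
  {ν : Measure β} [IsFiniteMeasure ν] {avg : β → α} {w : β → α → ℝ}

/-- ★ **THE MODULE PROPERTY OF THE WEIGHTED CONDITIONAL KERNEL STEP**: for bounded measurable `m` of the coarse level and `f` of the fine level,
`∫ m(V′)·(ofKernel κ_w).T f (V′) d(ν.map avg)(V′) = ∫ m(avg U)·(clampW (w U (avg U))·f U) dν(U)` — the kernel step integrates over the fibres of `avg`,
so a function of the new variable passes under it read on the graph (the disintegration `(ν.map avg) ⊗ condLaw ν avg = jointLaw ν avg` integrated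
against `m(V′)·clampW(w(U,V′))·f(U)`). [folklore] -/
theorem integral_mul_ofKernel_wCondKernel (havg : Measurable avg) (hw : Measurable fun z : α × β => w z.2 z.1) {m : α → ℝ}
    (hm : (bddMeas α).Gd m) {f : β → ℝ} (hf : (bddMeas β).Gd f) :
    ∫ a, m a * (@ofKernel β α _ _ (wCondKernel ν avg w) (wCondKernel_isFiniteKernel ν avg w)).T f a ∂(ν.map avg) =
      ∫ b, m (avg b) * (clampW (w b (avg b)) * f b) ∂ν := by
  obtain ⟨hmm, Bm, hBm⟩ := hm
  obtain ⟨hfm, Bf, hBf⟩ := hf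
  -- the integrand on the product (coarse, fine)
  set G : α × β → ℝ := fun z => m z.1 * (clampW (w z.2 z.1) * f z.2) with hG
  have hGm : Measurable G := (hmm.comp measurable_fst).mul ((measurable_clampW.comp hw).mul (hfm.comp measurable_snd))
  have hGb : ∀ z, |G z| ≤ |Bm| * |Bf| := fun z => by
    rw [hG, abs_mul, abs_mul, abs_of_nonneg (clampW_nonneg _)]
    calc |m z.1| * (clampW (w z.2 z.1) * |f z.2|) ≤ |Bm| * (1 * |Bf|) :=
          mul_le_mul ((hBm _).trans (le_abs_self _)) (mul_le_mul (clampW_le_one _) ((hBf _).trans (le_abs_self _))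
            (abs_nonneg _) zero_le_one) (mul_nonneg (clampW_nonneg _) (abs_nonneg _)) (abs_nonneg _)
      _ = |Bm| * |Bf| := by ring
  have hGgood : (bddMeas (α × β)).Gd G := ⟨hGm, |Bm| * |Bf|, hGb⟩
  -- step 1: push `m a` under the fibre integral and unfold the twisted kernel
  have e1 : ∀ a, m a * (@ofKernel β α _ _ (wCondKernel ν avg w) (wCondKernel_isFiniteKernel ν avg w)).T f a =
      ∫ b, G (a, b) ∂(condLaw ν avg a) := fun a => by
    rw [ofKernel_apply, integral_wCondKernel hw f a, ← integral_const_mul]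
  simp_rw [e1]
  -- step 2: the iterated integral is the integral against `(ν.map avg) ⊗ condLaw = jointLaw`, i.e. against `ν` along the graph
  have hGi : Integrable G (ν.map avg ⊗ₘ condLaw ν avg) := integrable_of_bddMeas _ hGgood
  rw [← Measure.integral_compProd hGi, ← jointLaw_fst ν havg, fst_compProd_condLaw ν avg,
    integral_jointLaw ν havg hGm.aestronglyMeasurable]

end Generic

/-! ## §2 OF RECORD: the label tower has the module property -/

section Record

variable (F : T4Family) (N : ℕ) [NeZero N] (ν : Stage7Numerics) (M : ℕ) (p : B12.RunParams) (g : ℕ → ℝ)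

/-- Bounded measurable functions of the averaged field pull back to bounded measurable functions of the fine field along the averaging of record
(n20-d's binder `havg`). [folklore] -/
theorem good_comp_avOfRecord (K j : ℕ) (m : cfgOfRecord F N K (j + 1) → ℝ) (hm : (bddMeas (cfgOfRecord F N K (j + 1))).Gd m) :
    (bddMeas (cfgOfRecord F N K j)).Gd fun U => m ((avOfRecord F N K j).avg U) := by
  obtain ⟨hmm, B, hB⟩ := hm
  exact ⟨hmm.comp (avOfRecord_measurable F N K j), B, fun U => hB _⟩

variable {A₁ : ℝ} {ζ : ZetaOfRecord F N ν M}

/-- ★★ **THE LABEL TOWER OF RECORD HAS THE MODULE PROPERTY** (n20-d's `…N20ByValueTelescoping` binder `hmod`, VERBATIM, at every level, history and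
choice): modulo the (O4) measurability of the label weights, for all bounded measurable `m` of level `j + 1` and `f` of level `j`,
`∫ m·(op j h q).T f dμ_{j+1} = ∫ (m ∘ avg_j)·(labelChi j h q·f) dμ_j`. [folklore] -/
theorem hmod_labelTower
    (hω : ∀ (k : ℕ) (s : SeqOfRecord F ν M g p.K k) (t : LbOfRecord F ν p g k),
      Measurable fun z : cfgOfRecord F N p.K (k + 1) × cfgOfRecord F N p.K k => ωOfRecord F N ν M p g k A₁ ζ s t z.2 z.1) :
    ∀ (j : ℕ) (h : Fin j → LabelPat F ν p g) (q : LabelPat F ν p g),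
      h ∈ (labelTowerOfRecord F N ν M p g A₁ ζ).adm j → q ∈ (labelTowerOfRecord F N ν M p g A₁ ζ).branch j h →
      ∀ (m : cfgOfRecord F N p.K (j + 1) → ℝ) (f : cfgOfRecord F N p.K j → ℝ),
        (bddMeas (cfgOfRecord F N p.K (j + 1))).Gd m → (bddMeas (cfgOfRecord F N p.K j)).Gd f →
        ∫ x, m x * ((labelTowerOfRecord F N ν M p g A₁ ζ).op j h q).T f x ∂(lawOfRecord F N p.K (j + 1)) =
          ∫ y, m ((avOfRecord F N p.K j).avg y) * (labelChi F N ν M p g A₁ ζ j h q y * f y) ∂(lawOfRecord F N p.K j) := by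
  intro j h q _ _ m f hm hf
  rw [lawOfRecord_succ]
  exact integral_mul_ofKernel_wCondKernel (avOfRecord_measurable F N p.K j) (hω j _ _) hm hf

/-! ## §3 The junction with n20-d's by-value telescoping -/

/-- ★ **THE LEVEL-`K` WEIGHT OF A LABEL HISTORY, BY VALUE** (n20-d's `integral_eterm_eq_pullAlong` ON THE LABEL TOWER): modulo the (O4) measurability,
for every bounded measurable `ρ₀` and every admissible label history `h` of length `K`,
`∫ eterm ρ₀ K h dμ_K = ∫ pullAlong avg labelChi K h · ρ₀ dU₀` — the bare-field integral of `ρ₀` against the product of the (clamped) label weights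
`ω_j(label_j)` read at `(avg^{j} U, avg^{j+1} U)` along the iterated block averages. [folklore] -/
theorem integral_eterm_labelTower_eq_pullAlong
    (hω : ∀ (k : ℕ) (s : SeqOfRecord F ν M g p.K k) (t : LbOfRecord F ν p g k),
      Measurable fun z : cfgOfRecord F N p.K (k + 1) × cfgOfRecord F N p.K k => ωOfRecord F N ν M p g k A₁ ζ s t z.2 z.1)
    {ρ₀ : cfgOfRecord F N p.K 0 → ℝ} (hρ : (bddMeas (cfgOfRecord F N p.K 0)).Gd ρ₀) (K : ℕ) (h : Fin K → LabelPat F ν p g)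
    (hh : h ∈ (labelTowerOfRecord F N ν M p g A₁ ζ).adm K) :
    ∫ x, (labelTowerOfRecord F N ν M p g A₁ ζ).eterm ρ₀ K h x ∂(lawOfRecord F N p.K K) =
      ∫ U, pullAlong (fun j => (avOfRecord F N p.K j).avg) (labelChi F N ν M p g A₁ ζ) K h U * ρ₀ U ∂(fieldMeasure (F.P p.K) 0 (SU N)) := by
  rw [← lawOfRecord_zero F N p.K]
  exact integral_eterm_eq_pullAlong (labelTowerOfRecord F N ν M p g A₁ ζ) (lawOfRecord F N p.K) (fun j => (avOfRecord F N p.K j).avg)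
    (labelChi F N ν M p g A₁ ζ) (fun j m hm => good_comp_avOfRecord F N p.K j m hm) (labelChi_good F N ν M p g hω)
    (hmod_labelTower F N ν M p g hω) hρ K h hh

open Classical in
/-- **CLASS SUMS BY VALUE ON THE LABEL TOWER** (n20-d's `sum_admS_integral_eterm_eq`): for every pattern `S` and level `K`,
`Σ_{h ∈ admS … S K} ∫ eterm ρ₀ K h dμ_K = ∫ (Σ_{h ∈ admS … S K} pullAlong avg labelChi K h)·ρ₀ dU₀`. [folklore] -/
theorem sum_admS_integral_labelTower_eq
    (hω : ∀ (k : ℕ) (s : SeqOfRecord F ν M g p.K k) (t : LbOfRecord F ν p g k),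
      Measurable fun z : cfgOfRecord F N p.K (k + 1) × cfgOfRecord F N p.K k => ωOfRecord F N ν M p g k A₁ ζ s t z.2 z.1)
    {ρ₀ : cfgOfRecord F N p.K 0 → ℝ} (hρ : (bddMeas (cfgOfRecord F N p.K 0)).Gd ρ₀) (S : (j : ℕ) → (Fin j → LabelPat F ν p g) → Finset (LabelPat F ν p g))
    (K : ℕ) :
    ∑ h ∈ admS (labelTowerOfRecord F N ν M p g A₁ ζ) S K, ∫ x, (labelTowerOfRecord F N ν M p g A₁ ζ).eterm ρ₀ K h x ∂(lawOfRecord F N p.K K) =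
      ∫ U, (∑ h ∈ admS (labelTowerOfRecord F N ν M p g A₁ ζ) S K,
          pullAlong (fun j => (avOfRecord F N p.K j).avg) (labelChi F N ν M p g A₁ ζ) K h U) * ρ₀ U ∂(fieldMeasure (F.P p.K) 0 (SU N)) := by
  rw [← lawOfRecord_zero F N p.K]
  exact sum_admS_integral_eterm_eq (labelTowerOfRecord F N ν M p g A₁ ζ) (lawOfRecord F N p.K) (fun j => (avOfRecord F N p.K j).avg)
    (labelChi F N ν M p g A₁ ζ) S (fun j m hm => good_comp_avOfRecord F N p.K j m hm) (labelChi_good F N ν M p g hω)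
    (hmod_labelTower F N ν M p g hω) hρ (fun f hf => integrable_of_bddMeas _ hf) K

open Classical in
/-- ★★★ **MODULE 28's CLASS WEIGHT BOUND, BY VALUE — ONE JOINT-SPARSENESS INEQUALITY UNDER THE BARE WILSON STATE.**  With the `δ₀ > 0`, `C ≥ 0` of
n20-d's cells Peierls bound and the residual binders of module 28 (`K ≥ 1`, `g₀⁻² ≥ 4N`, the two ζ-laws with (O4)-measurable label weights, a finite
family `D` of χ₁-cubes with regularity letters on pairwise disjoint regions of `≤ m` plaquettes (`m ≥ 1`), `ε″ ≥ 0`): for every cutoff `Kc + 1` and every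
label-family pattern `E` whose level-`0` families pin `D` into the new large-field family,
`∫ (Σ_{h ∈ admS (labelTowerOfRecord A₁ ζ) (labelPattern E) (Kc+1)} pullAlong avg labelChi (Kc+1) h)·ρ₀ dU₀ ≤ (m·e^{Cδ₀ − δ₀g₀⁻²ε″²∕(2N)})^{#D}·∫ ρ₀ dU₀`
— in the state `ρ₀ = e^{−E₀}e^{−g₀⁻²A}` on the level-`0` torus, the TOTAL PRODUCT WEIGHT of the label histories of length `Kc + 1` whose first label's
(3.2)-family contains `D` is at most ONE PEIERLS FACTOR PER PINNED CUBE. [folklore] -/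
theorem integral_sum_pullAlong_le_of_rootedAtZero :
    ∃ δ₀ : ℝ, 0 < δ₀ ∧ ∃ C : ℝ, 0 ≤ C ∧ ∀ (_hK : 1 ≤ p.K) (g₀ E₀ : ℝ), 4 * N ≤ g₀⁻¹ ^ 2 →
      ∀ (A₁ : ℝ) {ζ : ZetaOfRecord F N ν M}, IsZetaUnity F N ν M ζ → IsZetaAbsLeOne F N ν M ζ →
      (∀ (k : ℕ) (s : SeqOfRecord F ν M g p.K k) (t : LbOfRecord F ν p g k),
        Measurable fun z : cfgOfRecord F N p.K (k + 1) × cfgOfRecord F N p.K k => ωOfRecord F N ν M p g k A₁ ζ s t z.2 z.1) →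
      ∀ (D : Finset (Iχ F ν p g 0)) (R : Iχ F ν p g 0 → Finset (Plaq (F.P p.K) 1)) (m : ℕ) (ε'' : ℝ), 0 ≤ ε'' → 1 ≤ m →
        (∀ c ∈ D, (R c).card ≤ m) → (∀ c₁ ∈ D, ∀ c₂ ∈ D, c₁ ≠ c₂ → Disjoint (R c₁) (R c₂)) →
        (∀ c ∈ D, ∀ V' : GaugeField (F.P p.K) 1 (SU N),
          (∀ p' ∈ R c, dist1 (GaugeField.plaqHol V' p') < ε'') → chiFactor F N ν p g 0 c V' = 1) →
      ∀ (Kc : ℕ) (E : (j : ℕ) → (Fin j → LabelPat F ν p g) → Finset (LbOfRecord F ν p g j)), (∀ h t, t ∈ E 0 h → D ⊆ t.1) →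
        ∫ U, (∑ h ∈ admS (labelTowerOfRecord F N ν M p g A₁ ζ) (labelPattern F ν p g E) (Kc + 1),
            pullAlong (fun j => (avOfRecord F N p.K j).avg) (labelChi F N ν M p g A₁ ζ) (Kc + 1) h U) *
              rhoZeroOfRecord F N p.K g₀ E₀ U ∂(fieldMeasure (F.P p.K) 0 (SU N)) ≤
          ((m : ℝ) * Real.exp (C * δ₀ - δ₀ * g₀⁻¹ ^ 2 * (ε'' ^ 2 / (2 * (Fintype.card (Fin N) : ℝ))))) ^ D.card *
            ∫ U, rhoZeroOfRecord F N p.K g₀ E₀ U ∂(fieldMeasure (F.P p.K) 0 (SU N)) := by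
  obtain ⟨δ₀, hδ₀, C, hC, h⟩ := sum_admS_integral_le_labelTower_rootedAtZero F N ν M p g
  refine ⟨δ₀, hδ₀, C, hC, fun hK g₀ E₀ hg A₁ ζ hζu hζ hω D R m ε'' hε hm1 hm hdisj hreg Kc E hE0 => ?_⟩
  rw [← sum_admS_integral_labelTower_eq F N ν M p g hω (rhoZeroOfRecord_good F N p.K g₀ E₀) (labelPattern F ν p g E) (Kc + 1)]
  exact h hK g₀ E₀ hg A₁ hζu hζ hω D R m ε'' hε hm1 hm hdisj hreg Kc E hE0

end Record

end Summit.QuantumFields.YangMills.BalabanUVNodes.N20LCSLabelTowerByValue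

end
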